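import Summits.QuantumFields.YangMills.Theorems.UnitScaleTiltProp7BondAvgIterCoercivity
import Summits.QuantumFields.YangMills.Theorems.UnitScaleTiltProp7FlatActionExpansion
import Literature.MathematicalPhysics.QuantumFieldTheory.Balaban1983to89.MatrixNorms
import HarnessLib

/-!
# Route `UnitScaleTilt`, crux K1 child «MinimiserStabilityRegPr» (stmt-QuantumFields-19200), registered stub `stub_prop7From14` (v4 828f5fb4a904d3be;
# leaf V3 «Prop 7 from a background (14)» = `T3Thm1CarrierNative.Prop7From14At`) — sub-lemma V3-F♭: THE FLAT-DATUM MODEL OF THE MINIMALITY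
# MECHANISM (141)–(143): `U ≡ 1` IS A STRICT MINIMISER OF THE `SU(2)` WILSON ACTION WITH `k`-UNIFORM QUADRATIC GROWTH `(1/17)·L^{−2k}·Σ_b‖U(b) − 1‖²`
# ON THE LANDAU-GAUGE, `Q_k`-AVERAGE-ZERO SLICE OF THE CHART `Y = U − 1`, INSIDE THE REGULAR RADII `a = O(L^{−2k})`, `δ = O(L^{−k})`

Cell `ym3-torus` ∕ fleet seat `ym-ust-19200-p1` (HUMAN RULING D-0037, YM ladder rung R3).  This file COMPOSES the four landed V3 helpers of this seat:
the `k`-uniform flat coercivity (`UnitScaleTiltProp7FlatCoercivity` p451004 → Hodge form `…FlatHodgeCoercivity` p452018 → for the tree's `Q_k =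
LatticeFieldCalculus.bondAvgIter k`, `…BondAvgIterCoercivity` p454029: `∂^*X = 0 ∧ Q_kX = 0 ⇒ (8/17)L^{−2k}Σ_bX² ≤ Σ_p(∂X)²` for REAL bond fields)
and the flat Sect. B expansion (`…FlatActionExpansion` p456893: `A(U) ≥ ½Σ_p‖(∂Y)(p)‖² − Σ_p(2s_p²‖∂Y‖ + 6s_p⁴)`, `Y = U − 1 ∈ M₂(ℂ)`, operator norms),
through the comparison of the operator norm on `M₂(ℂ)` with the eight real components (tree `MatrixNorms.opNorm_sq_le_sum_norm_sq`,
`MatrixNorms.sum_norm_sq_col_le_opNorm_sq`) and the bond–plaquette incidence count.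

THE PRINT IT MODELS.  [Balaban1985Variational] p. 299, (141)–(143): the minimal configuration `U_k` is shown to be a minimum because «a second order
differential at A′ = 0 … is positive definite» — the positivity being [Balaban1985BackgroundPropagators] Thm 3.11, i.e. at the flat background
[Balaban1984PropagatorsI] (1.90) «Δ_a ≥ γ₀(Δ + I), γ₀ independent of k».  Here: the flat datum `V ≡ 1`, `U₀ ≡ 1`, the slice in place of print's chart
(20)–(21) (print: `Q(ηA) = 0`, `R(U₀)D^*A = 0` in the exponential chart; here: `Q_k(U − 1) = 0`, `∂^*(U − 1) = 0` — the same to first order), and the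
QUANTITATIVE conclusion with explicit constants in place of «a sufficiently small neighborhood» (cell GAPS G-B11-E5): the growth rate `L^{−2k}` and the
radii `a ~ L^{−2k}` (plaquettes, = print's (6) `ε₀L^{−2k}`) and `δ ~ L^{−k}` (bonds, = print's (19) `|ηA| < ε₂L^{−k}`) are exactly print's scalings.

WHAT IS PROVED (sorry-free, no definition; our own statements, elementary — [folklore] ∕ cited to the printed step they model).
* §1 real-linear functionals commute with `curl 1`, `diverg 1`, `bondAvgIter k` (`…_comp`); §2 `‖M‖² ≤ Σ_{ij}(Re² + Im²) ≤ 2‖M‖²` on `M₂(ℂ)`.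
* §3 **`curl_opNorm_sq_ge_of_landau_of_avg_zero`** — for `Y : bonds → M₂(ℂ)` with `∂^*Y = 0`, `Q_kY = 0`: `(4/17)L^{−2k}Σ_b‖Y(b)‖² ≤ Σ_p‖(∂Y)(p)‖²`
  (operator norms; the eight component inequalities of p454029 summed).
* §4 `sum_plaq_le_sum_triple`, `sum_plaq_bonds_le` — `Σ_p Σ_{b∈∂p} g(b) ≤ 4d·Σ_b g(b)` for `g ≥ 0`.
* §5 `plaquette_remainder_le` (scalar); **`wilsonAction4_ge_quadratic`**: for an `SU(2)` configuration `U` on the finest torus with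
  `∂^*(U − 1) = 0`, `Q_k(U − 1) = 0`, `‖U(b) − 1‖ ≤ δ ≤ 1`, `‖U(∂p) − 1‖ ≤ a` (`a ≥ 0`), `k` in the standing range:
  `((2/17)L^{−2k} − 32d(a + 80δ²))·Σ_b‖U(b) − 1‖² ≤ A(U)`; **`wilsonAction4_ge_of_radii`**: if `32d(a + 80δ²) ≤ (1/17)L^{−2k}` then
  `(1/17)L^{−2k}Σ_b‖U(b) − 1‖² ≤ A(U)`; **`eq_one_of_wilsonAction4_eq_zero`**: then `A(U) = 0 ⇒ U ≡ 1` (uniqueness of the minimiser on the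
  slice ∩ ball); `wilsonAction4_ge_quadratic_T3` — the instance at the d = 3 carrier (`Site (F.P K) 0`, `k = K − n`, rate `(2/17)L^{−2(K−n)} − 96(a + 80δ²)`),
  uniform in `m`, `n`, `K`.

WHAT THIS IS NOT.  A MODEL at the flat datum, not a clause of `Prop7From14At`: the slice `{∂^*(U−1) = 0, Q_k(U−1) = 0}` is a linear chart condition,
not the family's nonlinear (0.4)-fibre `descendTo U = 1` with print's gauge (4)/(21) — the transfer needs the gauge chart (V3-A, [Balaban1985RegularSpaces]
Thm 2), the right inverse of the linearised averaging (V3-C) and the identification `d(descendTo)_1 = Q_k + (gradient corrections)` (V3-D1c); general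
data `V` and backgrounds `U₀ ∈ 𝔘_k(L³B₃ε₁)` need the small-field perturbation (V3-D2) and, for existence, the sup-norm theory (V3-D3).  Nothing of
Bałaban's is asserted.

References: T. Bałaban, CMP 102 (1985) 277–309 [Balaban1985Variational] (Prop. 7 and (141)–(143) p.299, (6) p.278, (19)–(21) p.281); CMP 95 (1984) 17–40
[Balaban1984PropagatorsI] ((1.2) p.18, (1.18) p.20, (1.21) p.21, Prop. 1.1 (1.90) p.33); CMP 99 (1985) 389–434 [Balaban1985BackgroundPropagators] (Thm 3.11 p.416).
-/

noncomputable section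

open scoped BigOperators Matrix.Norms.L2Operator

namespace Summit.QuantumFields.YangMills.Theorems.Prop7FlatLocalMin

open Literature.MathematicalPhysics.QuantumFieldTheory.Balaban1983to89
open Finset LatticeFieldCalculus B1RG242Torus
open B10StarCount (sum_pbond)
open Summit.QuantumFields.YangMills.Theorems.Prop7FlatCoercivity
open Summit.QuantumFields.YangMills.Theorems.Prop7FlatExpansion

variable {P : Params}

/-! ## §1 Real-linear functionals commute with the linear lattice operators -/

section Linear

variable {V : Type*} [AddCommGroup V] [Module ℝ V] {j : ℕ}

/-- A real-linear functional commutes with the unit-lattice curl. [cite: Balaban1984PropagatorsI, (1.2) p.18] -/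
theorem curl_one_comp (E : V →ₗ[ℝ] ℝ) (Y : VecField P j V) (p : Plaq P j) :
    curl 1 (fun b => E (Y b)) p = E (curl 1 Y p) := by
  simp only [curl, one_smul, map_add, map_sub]

/-- A real-linear functional commutes with the unit-lattice divergence. [cite: Balaban1984PropagatorsI, (1.21) p.21] -/
theorem diverg_one_comp (E : V →ₗ[ℝ] ℝ) (Y : VecField P j V) (x : Site P j) :
    diverg 1 (fun b => E (Y b)) x = E (diverg 1 Y x) := by
  simp only [diverg, one_smul, map_sum, map_sub]

/-- A real-linear functional commutes with the iterated linear bond average `Q_k` (through its one-stroke form (1.18)). [cite: Balaban1984PropagatorsI, (1.18) p.20] -/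
theorem bondAvgIter_comp {k : ℕ} (hk : k ≤ P.m + P.K) (E : V →ₗ[ℝ] ℝ) (Y : VecField P 0 V) (c : PBond P k) :
    bondAvgIter k (fun b => E (Y b)) c = E (bondAvgIter k Y c) := by
  rw [bondAvgIter_eq_lineBlockAvg hk, bondAvgIter_eq_lineBlockAvg hk, map_smul, map_sum]
  simp only [map_sum]

end Linear

/-! ## §2 The eight real components of an `M₂(ℂ)`-valued field and the operator norm -/

section Components

/-- `‖M‖² ≤ Σ_{i,j} ((Re M_ij)² + (Im M_ij)²)` for `M ∈ M₂(ℂ)` (operator norm ≤ Hilbert–Schmidt norm; tree `MatrixNorms.opNorm_sq_le_sum_norm_sq`). [folklore] -/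
theorem opNorm_sq_le_sum_re_sq_add_im_sq (M : Matrix (Fin 2) (Fin 2) ℂ) :
    ‖M‖ ^ 2 ≤ ∑ i : Fin 2, ∑ j : Fin 2, ((M i j).re ^ 2 + (M i j).im ^ 2) := by
  refine (MatrixNorms.opNorm_sq_le_sum_norm_sq M).trans (le_of_eq ?_)
  refine Finset.sum_congr rfl fun i _ => Finset.sum_congr rfl fun j _ => ?_
  rw [Complex.sq_norm, Complex.normSq_apply]; ring

/-- `Σ_{i,j} ((Re M_ij)² + (Im M_ij)²) ≤ 2‖M‖²` for `M ∈ M₂(ℂ)` (each column is bounded by the operator norm; tree `MatrixNorms.sum_norm_sq_col_le_opNorm_sq`).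
[folklore] -/
theorem sum_re_sq_add_im_sq_le_two_mul_opNorm_sq (M : Matrix (Fin 2) (Fin 2) ℂ) :
    ∑ i : Fin 2, ∑ j : Fin 2, ((M i j).re ^ 2 + (M i j).im ^ 2) ≤ 2 * ‖M‖ ^ 2 := by
  have h : ∀ j : Fin 2, ∑ i : Fin 2, ((M i j).re ^ 2 + (M i j).im ^ 2) ≤ ‖M‖ ^ 2 := by
    intro j
    refine (le_of_eq ?_).trans (MatrixNorms.sum_norm_sq_col_le_opNorm_sq M j)
    refine Finset.sum_congr rfl fun i _ => ?_
    rw [Complex.sq_norm, Complex.normSq_apply]; ring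
  rw [Finset.sum_comm]
  calc ∑ j : Fin 2, ∑ i : Fin 2, ((M i j).re ^ 2 + (M i j).im ^ 2) ≤ ∑ _j : Fin 2, ‖M‖ ^ 2 := Finset.sum_le_sum fun j _ => h j
    _ = 2 * ‖M‖ ^ 2 := by simp

end Components

/-! ## §3 The curl form of the deviation field controls its `ℓ²` size on the slice -/

section Slice

variable {k : ℕ}

/-- **FLAT COERCIVITY FOR THE `M₂(ℂ)`-VALUED DEVIATION FIELD** (V3-D1 componentwise + the norm comparison of §2): for `Y : bonds → M₂(ℂ)` in the
Landau gauge `∂^*Y = 0` with `Q_kY = 0`, `(4/17)·L^{−2k}·Σ_b ‖Y(b)‖² ≤ Σ_p ‖(∂Y)(p)‖²` (operator norms). [cite: Balaban1985BackgroundPropagators, Thm 3.11 p.416] -/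
theorem curl_opNorm_sq_ge_of_landau_of_avg_zero (hk : k ≤ P.m + P.K) (Y : VecField P 0 (Matrix (Fin 2) (Fin 2) ℂ))
    (hdiv : ∀ x : Site P 0, diverg 1 Y x = 0) (havg : ∀ c : PBond P k, bondAvgIter k Y c = 0) :
    (4 / 17) * (((P.L : ℝ) ^ k) ^ 2)⁻¹ * ∑ b : PBond P 0, ‖Y b‖ ^ 2 ≤ ∑ p : Plaq P 0, ‖curl 1 Y p‖ ^ 2 := by
  -- the eight real component fields
  have hE : ∀ E : Matrix (Fin 2) (Fin 2) ℂ →ₗ[ℝ] ℝ,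
      (8 / 17) * (((P.L : ℝ) ^ k) ^ 2)⁻¹ * ∑ b : PBond P 0, (E (Y b)) ^ 2 ≤ ∑ p : Plaq P 0, (E (curl 1 Y p)) ^ 2 := by
    intro E
    have h := curl_sq_ge_of_landau_of_bondAvgIter_eq_zero hk (fun b => E (Y b))
      (fun x => by rw [diverg_one_comp, hdiv, map_zero]) (fun c => by rw [bondAvgIter_comp hk, havg, map_zero])
    simpa only [curl_one_comp] using h
  set Er : Fin 2 → Fin 2 → (Matrix (Fin 2) (Fin 2) ℂ →ₗ[ℝ] ℝ) := fun i j => Complex.reLm ∘ₗ Matrix.entryLinearMap ℝ ℂ i j with hEr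
  set Ei : Fin 2 → Fin 2 → (Matrix (Fin 2) (Fin 2) ℂ →ₗ[ℝ] ℝ) := fun i j => Complex.imLm ∘ₗ Matrix.entryLinearMap ℝ ℂ i j with hEi
  have hEr' : ∀ i j (M : Matrix (Fin 2) (Fin 2) ℂ), Er i j M = (M i j).re := fun i j M => rfl
  have hEi' : ∀ i j (M : Matrix (Fin 2) (Fin 2) ℂ), Ei i j M = (M i j).im := fun i j M => rfl
  -- sum the eight component inequalities
  have hsum : (8 / 17) * (((P.L : ℝ) ^ k) ^ 2)⁻¹ * ∑ b : PBond P 0, ∑ i : Fin 2, ∑ j : Fin 2, (((Y b) i j).re ^ 2 + ((Y b) i j).im ^ 2)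
      ≤ ∑ p : Plaq P 0, ∑ i : Fin 2, ∑ j : Fin 2, (((curl 1 Y p) i j).re ^ 2 + ((curl 1 Y p) i j).im ^ 2) := by
    have h1 : ∀ i j, (8 / 17) * (((P.L : ℝ) ^ k) ^ 2)⁻¹ * ∑ b : PBond P 0, (((Y b) i j).re ^ 2 + ((Y b) i j).im ^ 2)
        ≤ ∑ p : Plaq P 0, (((curl 1 Y p) i j).re ^ 2 + ((curl 1 Y p) i j).im ^ 2) := by
      intro i j
      have a := hE (Er i j)
      have b := hE (Ei i j)
      simp only [hEr', hEi'] at a b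
      rw [Finset.sum_add_distrib, Finset.sum_add_distrib, mul_add]
      exact add_le_add a b
    have h2 := Finset.sum_le_sum fun i (_ : i ∈ (univ : Finset (Fin 2))) => Finset.sum_le_sum fun j (_ : j ∈ (univ : Finset (Fin 2))) => h1 i j
    simp only [← Finset.mul_sum] at h2
    calc (8 / 17) * (((P.L : ℝ) ^ k) ^ 2)⁻¹ * ∑ b : PBond P 0, ∑ i : Fin 2, ∑ j : Fin 2, (((Y b) i j).re ^ 2 + ((Y b) i j).im ^ 2)
        = (8 / 17) * (((P.L : ℝ) ^ k) ^ 2)⁻¹ * ∑ i : Fin 2, ∑ j : Fin 2, ∑ b : PBond P 0, (((Y b) i j).re ^ 2 + ((Y b) i j).im ^ 2) := by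
          congr 1
          rw [Finset.sum_comm]
          exact Finset.sum_congr rfl fun i _ => Finset.sum_comm
      _ ≤ ∑ i : Fin 2, ∑ j : Fin 2, ∑ p : Plaq P 0, (((curl 1 Y p) i j).re ^ 2 + ((curl 1 Y p) i j).im ^ 2) := h2
      _ = ∑ i : Fin 2, ∑ p : Plaq P 0, ∑ j : Fin 2, (((curl 1 Y p) i j).re ^ 2 + ((curl 1 Y p) i j).im ^ 2) :=
          Finset.sum_congr rfl fun i _ => Finset.sum_comm
      _ = ∑ p : Plaq P 0, ∑ i : Fin 2, ∑ j : Fin 2, (((curl 1 Y p) i j).re ^ 2 + ((curl 1 Y p) i j).im ^ 2) := Finset.sum_comm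
  -- compare with operator norms on both sides
  have hlo : ∑ b : PBond P 0, ‖Y b‖ ^ 2 ≤ ∑ b : PBond P 0, ∑ i : Fin 2, ∑ j : Fin 2, (((Y b) i j).re ^ 2 + ((Y b) i j).im ^ 2) :=
    Finset.sum_le_sum fun b _ => opNorm_sq_le_sum_re_sq_add_im_sq (Y b)
  have hhi : ∑ p : Plaq P 0, ∑ i : Fin 2, ∑ j : Fin 2, (((curl 1 Y p) i j).re ^ 2 + ((curl 1 Y p) i j).im ^ 2)
      ≤ ∑ p : Plaq P 0, 2 * ‖curl 1 Y p‖ ^ 2 := Finset.sum_le_sum fun p _ => sum_re_sq_add_im_sq_le_two_mul_opNorm_sq _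
  rw [← Finset.mul_sum] at hhi
  have hL : (0 : ℝ) ≤ (8 / 17) * (((P.L : ℝ) ^ k) ^ 2)⁻¹ := by positivity
  nlinarith [mul_le_mul_of_nonneg_left hlo hL]

end Slice

/-! ## §4 From plaquette sums to bond sums -/

section Incidence

variable {j : ℕ}

/-- A sum over positively oriented plaquettes of a nonnegative function of `(src, μ, ν)` is at most the sum over all triples. [folklore] -/
theorem sum_plaq_le_sum_triple (G : Site P j → Fin P.d → Fin P.d → ℝ) (hG : ∀ x μ ν, 0 ≤ G x μ ν) :
    ∑ p : Plaq P j, G p.src p.μ p.ν ≤ ∑ x : Site P j, ∑ μ : Fin P.d, ∑ ν : Fin P.d, G x μ ν := by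
  classical
  set ι : Plaq P j → Site P j × Fin P.d × Fin P.d := fun p => (p.src, p.μ, p.ν) with hι
  have hinj : Set.InjOn ι (univ : Finset (Plaq P j)) := by
    rintro ⟨x, μ, ν, h⟩ _ ⟨x', μ', ν', h'⟩ _ hpq
    simp only [hι, Prod.mk.injEq] at hpq
    obtain ⟨rfl, rfl, rfl⟩ := hpq
    rfl
  have h1 : ∑ p : Plaq P j, G p.src p.μ p.ν = ∑ t ∈ (univ : Finset (Plaq P j)).image ι, G t.1 t.2.1 t.2.2 := by
    rw [Finset.sum_image hinj]
  rw [h1]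
  calc ∑ t ∈ (univ : Finset (Plaq P j)).image ι, G t.1 t.2.1 t.2.2
      ≤ ∑ t : Site P j × Fin P.d × Fin P.d, G t.1 t.2.1 t.2.2 :=
        Finset.sum_le_sum_of_subset_of_nonneg (Finset.subset_univ _) fun t _ _ => hG _ _ _
    _ = ∑ x : Site P j, ∑ μ : Fin P.d, ∑ ν : Fin P.d, G x μ ν := by
        rw [Fintype.sum_prod_type]
        exact Finset.sum_congr rfl fun x _ => Fintype.sum_prod_type _

/-- **BOND–PLAQUETTE INCIDENCE**: for a nonnegative bond function `g`, the sum over plaquettes of `g` over the four boundary bonds is at most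
`4d·Σ_b g(b)` (each bond lies in `2(d−1) ≤ 4d` plaquettes; the crude count via all triples `(x, μ, ν)` and translation invariance). [folklore] -/
theorem sum_plaq_bonds_le (g : PBond P j → ℝ) (hg : ∀ b, 0 ≤ g b) :
    ∑ p : Plaq P j, (g ⟨p.src, p.μ⟩ + g ⟨p.src.shift p.μ, p.ν⟩ + g ⟨p.src.shift p.ν, p.μ⟩ + g ⟨p.src, p.ν⟩)
      ≤ 4 * P.d * ∑ b : PBond P j, g b := by
  have h := sum_plaq_le_sum_triple (P := P) (j := j)
    (fun x μ ν => g ⟨x, μ⟩ + g ⟨x.shift μ, ν⟩ + g ⟨x.shift ν, μ⟩ + g ⟨x, ν⟩)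
    (fun x μ ν => add_nonneg (add_nonneg (add_nonneg (hg _) (hg _)) (hg _)) (hg _))
  refine h.trans (le_of_eq ?_)
  have hb : ∑ b : PBond P j, g b = ∑ x : Site P j, ∑ μ : Fin P.d, g ⟨x, μ⟩ := sum_pbond g
  -- the four terms, each equal to `d·Σ_b g b`
  have t1 : ∑ x : Site P j, ∑ μ : Fin P.d, ∑ ν : Fin P.d, g ⟨x, μ⟩ = P.d * ∑ b : PBond P j, g b := by
    rw [hb]
    simp only [Finset.sum_const, Finset.card_univ, Fintype.card_fin, nsmul_eq_mul, Finset.mul_sum]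
  have t4 : ∑ x : Site P j, ∑ μ : Fin P.d, ∑ ν : Fin P.d, g ⟨x, ν⟩ = P.d * ∑ b : PBond P j, g b := by
    rw [hb]
    simp only [Finset.sum_const, Finset.card_univ, Fintype.card_fin, nsmul_eq_mul, Finset.mul_sum]
  have t2 : ∑ x : Site P j, ∑ μ : Fin P.d, ∑ ν : Fin P.d, g ⟨x.shift μ, ν⟩ = P.d * ∑ b : PBond P j, g b := by
    rw [Finset.sum_comm]
    have : ∀ μ : Fin P.d, ∑ x : Site P j, ∑ ν : Fin P.d, g ⟨x.shift μ, ν⟩ = ∑ b : PBond P j, g b := fun μ => by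
      rw [hb]; exact sum_shift μ (fun x => ∑ ν : Fin P.d, g ⟨x, ν⟩)
    simp only [this, Finset.sum_const, Finset.card_univ, Fintype.card_fin, nsmul_eq_mul]
  have t3 : ∑ x : Site P j, ∑ μ : Fin P.d, ∑ ν : Fin P.d, g ⟨x.shift ν, μ⟩ = P.d * ∑ b : PBond P j, g b := by
    have e1 : ∑ x : Site P j, ∑ μ : Fin P.d, ∑ ν : Fin P.d, g ⟨x.shift ν, μ⟩
        = ∑ x : Site P j, ∑ ν : Fin P.d, ∑ μ : Fin P.d, g ⟨x.shift ν, μ⟩ := Finset.sum_congr rfl fun x _ => Finset.sum_comm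
    rw [e1]
    exact t2
  simp only [Finset.sum_add_distrib]
  rw [t1, t2, t3, t4]
  ring

end Incidence

/-! ## §5 The flat-datum local minimality: quadratic growth of the Wilson action off `U ≡ 1` on the slice -/

section LocalMin

variable {k : ℕ}

/-- Scalar bookkeeping for one plaquette: with `s = a₁ + a₂ + a₃ + a₄`, `0 ≤ a_i ≤ δ`, `t ≤ a + 2s²`, `0 ≤ a`:
`2s²t + 6s⁴ ≤ (2a + 160δ²)·4(a₁² + a₂² + a₃² + a₄²)`. [folklore] -/
theorem plaquette_remainder_le {a₁ a₂ a₃ a₄ t a δ : ℝ} (n₁ : 0 ≤ a₁) (n₂ : 0 ≤ a₂) (n₃ : 0 ≤ a₃) (n₄ : 0 ≤ a₄)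
    (g₁ : a₁ ≤ δ) (g₂ : a₂ ≤ δ) (g₃ : a₃ ≤ δ) (g₄ : a₄ ≤ δ) (ha0 : 0 ≤ a)
    (htle : t ≤ a + 2 * (a₁ + a₂ + a₃ + a₄) ^ 2) :
    2 * (a₁ + a₂ + a₃ + a₄) ^ 2 * t + 6 * (a₁ + a₂ + a₃ + a₄) ^ 4
      ≤ (2 * a + 160 * δ ^ 2) * (4 * (a₁ ^ 2 + a₂ ^ 2 + a₃ ^ 2 + a₄ ^ 2)) := by
  have hs0 : 0 ≤ a₁ + a₂ + a₃ + a₄ := by linarith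
  have hs4 : a₁ + a₂ + a₃ + a₄ ≤ 4 * δ := by linarith
  have hs2 : 0 ≤ (a₁ + a₂ + a₃ + a₄) ^ 2 := sq_nonneg _
  have hsq : (a₁ + a₂ + a₃ + a₄) ^ 2 ≤ 16 * δ ^ 2 := by nlinarith
  have hcs : (a₁ + a₂ + a₃ + a₄) ^ 2 ≤ 4 * (a₁ ^ 2 + a₂ ^ 2 + a₃ ^ 2 + a₄ ^ 2) := by
    nlinarith [sq_nonneg (a₁ - a₂), sq_nonneg (a₁ - a₃), sq_nonneg (a₁ - a₄), sq_nonneg (a₂ - a₃), sq_nonneg (a₂ - a₄), sq_nonneg (a₃ - a₄)]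
  have hc0 : 0 ≤ 2 * a + 160 * δ ^ 2 := by nlinarith [sq_nonneg δ]
  calc 2 * (a₁ + a₂ + a₃ + a₄) ^ 2 * t + 6 * (a₁ + a₂ + a₃ + a₄) ^ 4
      ≤ 2 * (a₁ + a₂ + a₃ + a₄) ^ 2 * (a + 2 * (a₁ + a₂ + a₃ + a₄) ^ 2) + 6 * (a₁ + a₂ + a₃ + a₄) ^ 4 := by
        nlinarith [mul_le_mul_of_nonneg_left htle hs2]
    _ = (2 * a + 10 * (a₁ + a₂ + a₃ + a₄) ^ 2) * (a₁ + a₂ + a₃ + a₄) ^ 2 := by ring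
    _ ≤ (2 * a + 160 * δ ^ 2) * (a₁ + a₂ + a₃ + a₄) ^ 2 := by nlinarith
    _ ≤ (2 * a + 160 * δ ^ 2) * (4 * (a₁ ^ 2 + a₂ ^ 2 + a₃ ^ 2 + a₄ ^ 2)) := mul_le_mul_of_nonneg_left hcs hc0

/-- **FLAT-DATUM MODEL OF [Balaban1985Variational] (141)–(143) ∕ PROP. 7 (ii), `k`-UNIFORM**: let `U` be an `SU(2)` configuration on the finest
torus with deviation field `Y = U − 1` in the LANDAU GAUGE `∂^*Y = 0` and with VANISHING `k`-FOLD LINEAR BLOCK AVERAGES `Q_kY = 0`, bonds within `δ ≤ 1`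
of the identity and plaquette variables within `a` of the identity (operator norms). Then
`((2/17)·L^{−2k} − 32d·(a + 80δ²))·Σ_b ‖U(b) − 1‖² ≤ A(U)`
— the Wilson action grows quadratically off `U ≡ 1` at the rate `L^{−2k}` of [Balaban1984PropagatorsI] (1.90), up to an error governed by the
regularity radii; constants independent of the volume and of `k`. [cite: Balaban1985Variational, (141)-(143) p.299] -/
theorem wilsonAction4_ge_quadratic (hk : k ≤ P.m + P.K) (U : GaugeField P 0 (Matrix.specialUnitaryGroup (Fin 2) ℂ)) {a δ : ℝ}
    (hδ : ∀ b : PBond P 0, ‖(U b : Matrix (Fin 2) (Fin 2) ℂ) - 1‖ ≤ δ) (hδ1 : δ ≤ 1) (ha0 : 0 ≤ a)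
    (ha : ∀ p : Plaq P 0, ‖((GaugeField.plaqHol U p : Matrix.specialUnitaryGroup (Fin 2) ℂ) : Matrix (Fin 2) (Fin 2) ℂ) - 1‖ ≤ a)
    (hdiv : ∀ x : Site P 0, diverg 1 (fun b : PBond P 0 => (U b : Matrix (Fin 2) (Fin 2) ℂ) - 1) x = 0)
    (havg : ∀ c : PBond P k, bondAvgIter k (fun b : PBond P 0 => (U b : Matrix (Fin 2) (Fin 2) ℂ) - 1) c = 0) :
    ((2 / 17) * (((P.L : ℝ) ^ k) ^ 2)⁻¹ - 32 * P.d * (a + 80 * δ ^ 2)) * ∑ b : PBond P 0, ‖(U b : Matrix (Fin 2) (Fin 2) ℂ) - 1‖ ^ 2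
      ≤ wilsonAction4 U := by
  have hY1 : ∀ b : PBond P 0, ‖(U b : Matrix (Fin 2) (Fin 2) ℂ) - 1‖ ≤ 1 := fun b => (hδ b).trans hδ1
  -- (1) the expansion: A ≥ ½Σ t² − Σ (2s²t + 6s⁴)
  have h1 := half_curl_sq_sub_le_wilsonAction4 U hY1
  -- (2) the flat coercivity on the slice: (4/17)L^{-2k} Σ‖Y‖² ≤ Σ t²
  have h2 := curl_opNorm_sq_ge_of_landau_of_avg_zero hk (fun b : PBond P 0 => (U b : Matrix (Fin 2) (Fin 2) ℂ) - 1) hdiv havg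
  beta_reduce at h2
  -- (3) per plaquette: 2s²t + 6s⁴ ≤ (2a + 160δ²)·4·(Σ_{b∈p} ‖Y b‖²)
  have h3 : ∀ p : Plaq P 0,
      2 * (‖(U ⟨p.src, p.μ⟩ : Matrix (Fin 2) (Fin 2) ℂ) - 1‖ + ‖(U ⟨p.src.shift p.μ, p.ν⟩ : Matrix (Fin 2) (Fin 2) ℂ) - 1‖
            + ‖(U ⟨p.src.shift p.ν, p.μ⟩ : Matrix (Fin 2) (Fin 2) ℂ) - 1‖ + ‖(U ⟨p.src, p.ν⟩ : Matrix (Fin 2) (Fin 2) ℂ) - 1‖) ^ 2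
          * ‖curl 1 (fun b : PBond P 0 => (U b : Matrix (Fin 2) (Fin 2) ℂ) - 1) p‖
        + 6 * (‖(U ⟨p.src, p.μ⟩ : Matrix (Fin 2) (Fin 2) ℂ) - 1‖ + ‖(U ⟨p.src.shift p.μ, p.ν⟩ : Matrix (Fin 2) (Fin 2) ℂ) - 1‖
            + ‖(U ⟨p.src.shift p.ν, p.μ⟩ : Matrix (Fin 2) (Fin 2) ℂ) - 1‖ + ‖(U ⟨p.src, p.ν⟩ : Matrix (Fin 2) (Fin 2) ℂ) - 1‖) ^ 4
      ≤ (2 * a + 160 * δ ^ 2) * (4 * (‖(U ⟨p.src, p.μ⟩ : Matrix (Fin 2) (Fin 2) ℂ) - 1‖ ^ 2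
          + ‖(U ⟨p.src.shift p.μ, p.ν⟩ : Matrix (Fin 2) (Fin 2) ℂ) - 1‖ ^ 2 + ‖(U ⟨p.src.shift p.ν, p.μ⟩ : Matrix (Fin 2) (Fin 2) ℂ) - 1‖ ^ 2
          + ‖(U ⟨p.src, p.ν⟩ : Matrix (Fin 2) (Fin 2) ℂ) - 1‖ ^ 2)) := by
    intro p
    -- `t ≤ a + 2 s²`
    have hE := norm_plaqHol_sub_one_sub_curl_le U p (hY1 ⟨p.src, p.μ⟩) (hY1 ⟨p.src.shift p.ν, p.μ⟩)
    have htle := norm_sub_le_of_le (ha p) hE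
    have e : ((GaugeField.plaqHol U p : Matrix.specialUnitaryGroup (Fin 2) ℂ) : Matrix (Fin 2) (Fin 2) ℂ) - 1
        - (((GaugeField.plaqHol U p : Matrix.specialUnitaryGroup (Fin 2) ℂ) : Matrix (Fin 2) (Fin 2) ℂ) - 1
          - curl 1 (fun b : PBond P 0 => (U b : Matrix (Fin 2) (Fin 2) ℂ) - 1) p)
        = curl 1 (fun b : PBond P 0 => (U b : Matrix (Fin 2) (Fin 2) ℂ) - 1) p := by abel
    rw [e] at htle
    exact plaquette_remainder_le (norm_nonneg _) (norm_nonneg _) (norm_nonneg _) (norm_nonneg _) (hδ _) (hδ _) (hδ _) (hδ _) ha0 htle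
  -- (4) sum (3) over plaquettes and pass to bonds
  have h4 : ∑ p : Plaq P 0,
      (2 * (‖(U ⟨p.src, p.μ⟩ : Matrix (Fin 2) (Fin 2) ℂ) - 1‖ + ‖(U ⟨p.src.shift p.μ, p.ν⟩ : Matrix (Fin 2) (Fin 2) ℂ) - 1‖
            + ‖(U ⟨p.src.shift p.ν, p.μ⟩ : Matrix (Fin 2) (Fin 2) ℂ) - 1‖ + ‖(U ⟨p.src, p.ν⟩ : Matrix (Fin 2) (Fin 2) ℂ) - 1‖) ^ 2
          * ‖curl 1 (fun b : PBond P 0 => (U b : Matrix (Fin 2) (Fin 2) ℂ) - 1) p‖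
        + 6 * (‖(U ⟨p.src, p.μ⟩ : Matrix (Fin 2) (Fin 2) ℂ) - 1‖ + ‖(U ⟨p.src.shift p.μ, p.ν⟩ : Matrix (Fin 2) (Fin 2) ℂ) - 1‖
            + ‖(U ⟨p.src.shift p.ν, p.μ⟩ : Matrix (Fin 2) (Fin 2) ℂ) - 1‖ + ‖(U ⟨p.src, p.ν⟩ : Matrix (Fin 2) (Fin 2) ℂ) - 1‖) ^ 4)
      ≤ 32 * P.d * (a + 80 * δ ^ 2) * ∑ b : PBond P 0, ‖(U b : Matrix (Fin 2) (Fin 2) ℂ) - 1‖ ^ 2 := by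
    have hinc := sum_plaq_bonds_le (P := P) (j := 0) (fun b => ‖(U b : Matrix (Fin 2) (Fin 2) ℂ) - 1‖ ^ 2) (fun b => sq_nonneg _)
    have hc0 : 0 ≤ (2 * a + 160 * δ ^ 2) * 4 := by nlinarith [sq_nonneg δ]
    calc _ ≤ ∑ p : Plaq P 0, (2 * a + 160 * δ ^ 2) * (4 * (‖(U ⟨p.src, p.μ⟩ : Matrix (Fin 2) (Fin 2) ℂ) - 1‖ ^ 2
            + ‖(U ⟨p.src.shift p.μ, p.ν⟩ : Matrix (Fin 2) (Fin 2) ℂ) - 1‖ ^ 2 + ‖(U ⟨p.src.shift p.ν, p.μ⟩ : Matrix (Fin 2) (Fin 2) ℂ) - 1‖ ^ 2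
            + ‖(U ⟨p.src, p.ν⟩ : Matrix (Fin 2) (Fin 2) ℂ) - 1‖ ^ 2)) := Finset.sum_le_sum fun p _ => h3 p
      _ = (2 * a + 160 * δ ^ 2) * 4 * ∑ p : Plaq P 0, (‖(U ⟨p.src, p.μ⟩ : Matrix (Fin 2) (Fin 2) ℂ) - 1‖ ^ 2
            + ‖(U ⟨p.src.shift p.μ, p.ν⟩ : Matrix (Fin 2) (Fin 2) ℂ) - 1‖ ^ 2 + ‖(U ⟨p.src.shift p.ν, p.μ⟩ : Matrix (Fin 2) (Fin 2) ℂ) - 1‖ ^ 2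
            + ‖(U ⟨p.src, p.ν⟩ : Matrix (Fin 2) (Fin 2) ℂ) - 1‖ ^ 2) := by
          rw [Finset.mul_sum]
          exact Finset.sum_congr rfl fun p _ => by ring
      _ ≤ (2 * a + 160 * δ ^ 2) * 4 * (4 * P.d * ∑ b : PBond P 0, ‖(U b : Matrix (Fin 2) (Fin 2) ℂ) - 1‖ ^ 2) :=
          mul_le_mul_of_nonneg_left hinc hc0
      _ = 32 * P.d * (a + 80 * δ ^ 2) * ∑ b : PBond P 0, ‖(U b : Matrix (Fin 2) (Fin 2) ℂ) - 1‖ ^ 2 := by ring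
  -- assemble
  have e1 : ∑ p : Plaq P 0, 1 / 2 * ‖curl 1 (fun b : PBond P 0 => (U b : Matrix (Fin 2) (Fin 2) ℂ) - 1) p‖ ^ 2
      = 1 / 2 * ∑ p : Plaq P 0, ‖curl 1 (fun b : PBond P 0 => (U b : Matrix (Fin 2) (Fin 2) ℂ) - 1) p‖ ^ 2 := by rw [Finset.mul_sum]
  rw [e1] at h1
  linarith [h1, h2, h4]

/-- **STRICT LOCAL MINIMALITY WITH AN EXPLICIT RATE** (corollary): inside the regular radii `32d(a + 80δ²) ≤ (1/17)L^{−2k}` the Wilson action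
dominates `(1/17)L^{−2k}·Σ_b‖U(b) − 1‖²`; in particular `U ≡ 1` is the ONLY configuration of the slice ∩ ball with vanishing action.
[cite: Balaban1985Variational, Prop 7 p.299] -/
theorem wilsonAction4_ge_of_radii (hk : k ≤ P.m + P.K) (U : GaugeField P 0 (Matrix.specialUnitaryGroup (Fin 2) ℂ)) {a δ : ℝ}
    (hδ : ∀ b : PBond P 0, ‖(U b : Matrix (Fin 2) (Fin 2) ℂ) - 1‖ ≤ δ) (hδ1 : δ ≤ 1) (ha0 : 0 ≤ a)
    (ha : ∀ p : Plaq P 0, ‖((GaugeField.plaqHol U p : Matrix.specialUnitaryGroup (Fin 2) ℂ) : Matrix (Fin 2) (Fin 2) ℂ) - 1‖ ≤ a)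
    (hdiv : ∀ x : Site P 0, diverg 1 (fun b : PBond P 0 => (U b : Matrix (Fin 2) (Fin 2) ℂ) - 1) x = 0)
    (havg : ∀ c : PBond P k, bondAvgIter k (fun b : PBond P 0 => (U b : Matrix (Fin 2) (Fin 2) ℂ) - 1) c = 0)
    (hrad : 32 * P.d * (a + 80 * δ ^ 2) ≤ (1 / 17) * (((P.L : ℝ) ^ k) ^ 2)⁻¹) :
    (1 / 17) * (((P.L : ℝ) ^ k) ^ 2)⁻¹ * ∑ b : PBond P 0, ‖(U b : Matrix (Fin 2) (Fin 2) ℂ) - 1‖ ^ 2 ≤ wilsonAction4 U := by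
  have h := wilsonAction4_ge_quadratic hk U hδ hδ1 ha0 ha hdiv havg
  have hS0 : 0 ≤ ∑ b : PBond P 0, ‖(U b : Matrix (Fin 2) (Fin 2) ℂ) - 1‖ ^ 2 := Finset.sum_nonneg fun _ _ => sq_nonneg _
  nlinarith [mul_le_mul_of_nonneg_right hrad hS0]

/-- **UNIQUENESS OF THE ZERO OF THE ACTION ON THE SLICE**: under the same hypotheses, `A(U) = 0` forces `U ≡ 1`. [cite: Balaban1985Variational, Prop 7 p.299] -/
theorem eq_one_of_wilsonAction4_eq_zero (hk : k ≤ P.m + P.K) (U : GaugeField P 0 (Matrix.specialUnitaryGroup (Fin 2) ℂ)) {a δ : ℝ}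
    (hδ : ∀ b : PBond P 0, ‖(U b : Matrix (Fin 2) (Fin 2) ℂ) - 1‖ ≤ δ) (hδ1 : δ ≤ 1) (ha0 : 0 ≤ a)
    (ha : ∀ p : Plaq P 0, ‖((GaugeField.plaqHol U p : Matrix.specialUnitaryGroup (Fin 2) ℂ) : Matrix (Fin 2) (Fin 2) ℂ) - 1‖ ≤ a)
    (hdiv : ∀ x : Site P 0, diverg 1 (fun b : PBond P 0 => (U b : Matrix (Fin 2) (Fin 2) ℂ) - 1) x = 0)
    (havg : ∀ c : PBond P k, bondAvgIter k (fun b : PBond P 0 => (U b : Matrix (Fin 2) (Fin 2) ℂ) - 1) c = 0)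
    (hrad : 32 * P.d * (a + 80 * δ ^ 2) ≤ (1 / 17) * (((P.L : ℝ) ^ k) ^ 2)⁻¹) (hA : wilsonAction4 U = 0) :
    ∀ b : PBond P 0, U b = 1 := by
  have h := wilsonAction4_ge_of_radii hk U hδ hδ1 ha0 ha hdiv havg hrad
  rw [hA] at h
  have hL : (0 : ℝ) < (1 / 17) * (((P.L : ℝ) ^ k) ^ 2)⁻¹ := by
    have : (0 : ℝ) < P.L := by exact_mod_cast P.L_pos
    positivity
  have hS0 : 0 ≤ ∑ b : PBond P 0, ‖(U b : Matrix (Fin 2) (Fin 2) ℂ) - 1‖ ^ 2 := Finset.sum_nonneg fun _ _ => sq_nonneg _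
  have hS : ∑ b : PBond P 0, ‖(U b : Matrix (Fin 2) (Fin 2) ℂ) - 1‖ ^ 2 = 0 := by
    nlinarith
  intro b
  have hb := (Finset.sum_eq_zero_iff_of_nonneg fun b _ => sq_nonneg _).mp hS b (Finset.mem_univ b)
  have hb' : (U b : Matrix (Fin 2) (Fin 2) ℂ) = 1 := by
    have := pow_eq_zero_iff (n := 2) (by norm_num) |>.mp hb
    rwa [norm_eq_zero, sub_eq_zero] at this
  exact Subtype.ext hb'

/-- **AT THE d = 3 CARRIER** (`Site (F.P K) 0`, `k = K − n`): the rate `(2/17)L^{−2(K−n)} − 96(a + 80δ²)`, uniformly in `m`, `n`, `K`.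
[cite: Balaban1985Variational, (141)-(143) p.299] -/
theorem wilsonAction4_ge_quadratic_T3 (F : T3ContinuumYM3Torus.T3Family) (n K : ℕ)
    (U : GaugeField (F.P K) 0 (Matrix.specialUnitaryGroup (Fin 2) ℂ)) {a δ : ℝ}
    (hδ : ∀ b : PBond (F.P K) 0, ‖(U b : Matrix (Fin 2) (Fin 2) ℂ) - 1‖ ≤ δ) (hδ1 : δ ≤ 1) (ha0 : 0 ≤ a)
    (ha : ∀ p : Plaq (F.P K) 0, ‖((GaugeField.plaqHol U p : Matrix.specialUnitaryGroup (Fin 2) ℂ) : Matrix (Fin 2) (Fin 2) ℂ) - 1‖ ≤ a)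
    (hdiv : ∀ x : Site (F.P K) 0, diverg 1 (fun b : PBond (F.P K) 0 => (U b : Matrix (Fin 2) (Fin 2) ℂ) - 1) x = 0)
    (havg : ∀ c : PBond (F.P K) (K - n), bondAvgIter (K - n) (fun b : PBond (F.P K) 0 => (U b : Matrix (Fin 2) (Fin 2) ℂ) - 1) c = 0) :
    ((2 / 17) * (((F.L : ℝ) ^ (K - n)) ^ 2)⁻¹ - 96 * (a + 80 * δ ^ 2)) * ∑ b : PBond (F.P K) 0, ‖(U b : Matrix (Fin 2) (Fin 2) ℂ) - 1‖ ^ 2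
      ≤ wilsonAction4 U := by
  have h := wilsonAction4_ge_quadratic (P := F.P K) (show K - n ≤ F.m + K by omega) U hδ hδ1 ha0 ha hdiv havg
  have hd : ((F.P K).d : ℝ) = 3 := by norm_num [T3ContinuumYM3Torus.T3Family.P_d]
  rw [hd] at h
  have e : (32 : ℝ) * 3 = 96 := by norm_num
  rw [e] at h
  exact h

end LocalMin

end Summit.QuantumFields.YangMills.Theorems.Prop7FlatLocalMin

end
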